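import Literature.AlgebraicGeometry.Hu2025.Proofs.S04ModelV.RootParentsR3
import Literature.AlgebraicGeometry.Hu2025.Proofs.S04ModelV.RootParentsPlatformSix
import HarnessLib

/-!
# Hu 2025 §4.2.2, the remark after Ex. 4.14 ‹chunk 4.13› «a ℘-binomial does not admit any non-zero root parent» AT THE
# PLATFORM `Gr^{3,6}` IN READING R3 (row 103 file d `C23L47_R3`): it HOLDS — the «no double lift» hypothesis of
# `RootParentsR3.C23L47_R3_of_noDoubleLift` is a `decide`d fact about the 31 terms of the 10 primary relations of `Gr^{3,6}`
# (file `Proofs/S04ModelV/RootParentsR3PlatformSix.lean`; typer of record res-type-042, row 103)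

**HONEST FRAMING (D-0012/D-0089).** Kernel facts about OUR typed renderings at the row-101/102/105 platform data
(res-type-009 / res-type-079: `primaryTerms`, `relN`, `monoN`, `headN`). With `RootParentsPlatformSix.lean` this file gives
the three-reading census of the sentence chunk p0023 l.47–48 / PDF p.50 L027 at `Gr^{3,6}` (`C23L47_readings_platform_six`):
R1 (res-type-044's parents, arbitrary cofactors) REFUTABLE AS TYPED · R2 (term-wise, `f̄` unrestricted) REFUTABLE AS TYPED ·
R3 (term-wise, `f̄` written without cancellation) HOLDS. Which reading the print intends is for the lanes / res-adj; the
preprint [Hu2025] (arXiv:2507.21400v1) stays «under review»; nothing of it is asserted; AI proof is weaker than expert review;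
nothing here is progress on resolution of singularities.

The platform facts (displays (3.10)–(3.13) at `n = 6`): (A) if the chart monomial `x̄_h = x̄_{u_h} x̄_{v_h}` of a term `h` divides
the chart monomial of a term `t`, then `h = t` or `h` is the LEADING term of ANOTHER block (`termN_lift_cases_six`: the only
foreign divisors are the leading variables `x_{3bc}, x_{2bc}, x_{1bc}` of rank-0 blocks inside the tail monomials
`x_{12a}x_{3bc}, x_{13a}x_{2bc}, x_{23a}x_{1bc}` of the rank-1 block `F̄_{(123),(456)}`); (B) no leading variable divides the
chart monomials of two distinct terms of one block (`head_not_double_six`). Hence NO DOUBLE LIFT (`noDoubleLift_six`).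
-/

noncomputable section

namespace Literature.AlgebraicGeometry.Hu2025.Proofs.S04ModelV

open MvPolynomial Literature.AlgebraicGeometry.Hu2025.Statements.S03Pluecker
  Literature.AlgebraicGeometry.Hu2025.Statements.S04ModelV

/-- At `Gr^{3,6}`: the second index triple `v_s` of a term is `m = (123)` (leading terms) or a Plücker variable index.
[cite: Hu2025, §3 (3.10)–(3.13) at n = 6, chunk p0018 l.17–33, p.37 (unrefereed preprint arXiv:2507.21400v1 under adjudication, D-0012/D-0089 — kernel bookkeeping on OUR typed carriers of rows 101/105; nothing of the source asserted)] -/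
theorem termN_vs_six : ∀ h : TermIdx 6, (termN h).vs = mTri ∨ (termN h).vs ∈ plVarSet 6 := by
  decide

-- The next two `decide`s quantify over pairs / triples drawn from the 31 terms of `Gr^{3,6}`; the `Decidable` instance of the
-- nested bounded statement is larger than the default synthesis budget (no mathematics in the options).
set_option synthInstance.maxHeartbeats 400000 in
set_option synthInstance.maxSize 4096 in
/-- **(A) at `Gr^{3,6}`**: if both index triples of the term `h` occur among those of the term `t` (`v_h = m` allowed), then
`h = t`, or `h` is the leading term of a block other than that of `t`.
[cite: Hu2025, §3 (3.10)–(3.13) at n = 6, chunk p0018 l.17–33, p.37 (unrefereed preprint arXiv:2507.21400v1 under adjudication, D-0012/D-0089 — kernel bookkeeping on OUR typed carriers of rows 101/105; nothing of the source asserted)] -/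
theorem termN_lift_cases_six : ∀ h t : TermIdx 6,
    ((termN h).us = (termN t).us ∨ (termN h).us = (termN t).vs) →
    ((termN h).vs = mTri ∨ (termN h).vs = (termN t).us ∨ (termN h).vs = (termN t).vs) →
    h = t ∨ (relN 6 h ≠ relN 6 t ∧ h = headN 6 (relN 6 h)) := by
  decide

set_option synthInstance.maxHeartbeats 400000 in
set_option synthInstance.maxSize 4096 in
/-- **(B) at `Gr^{3,6}`**: no leading index `u_G` occurs among the index triples of two distinct terms of one block.
[cite: Hu2025, §3 (3.10)–(3.13) at n = 6, chunk p0018 l.17–33, p.37 (unrefereed preprint arXiv:2507.21400v1 under adjudication, D-0012/D-0089 — kernel bookkeeping on OUR typed carriers of rows 101/105; nothing of the source asserted)] -/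
theorem head_not_double_six : ∀ G : RelIdx 6, ∀ t t' : TermIdx 6, relN 6 t = relN 6 t' → t ≠ t' →
    ((termN (headN 6 G)).us = (termN t).us ∨ (termN (headN 6 G)).us = (termN t).vs) →
    ((termN (headN 6 G)).us = (termN t').us ∨ (termN (headN 6 G)).us = (termN t').vs) → False := by
  decide

/-- The second index `v_s` of a tail term occurs in its chart monomial (at `Gr^{3,6}`).
[cite: Hu2025, §3 (3.15) / §4.1 (4.7), chunks p0018 l.48–51 / p0021 l.122–132, pp. 38, 46 (unrefereed preprint arXiv:2507.21400v1 under adjudication, D-0012/D-0089 — kernel bookkeeping on OUR typed carriers of rows 101/105; nothing of the source asserted)] -/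
theorem vs_mem_support_monoN_six (h : TermIdx 6) (hv : (termN h).vs ∈ plVarSet 6) :
    (⟨(termN h).vs, hv⟩ : plVar 6) ∈ (monoN 6 h).support := by
  rw [Finsupp.mem_support_iff, monoN, Finsupp.add_apply]
  have h1 : (plExp (n := 6) (termN h).vs) ⟨(termN h).vs, hv⟩ = 1 := by
    unfold plExp
    rw [dif_pos hv, Finsupp.single_eq_same]
  omega

/-- **Bridge**: divisibility of chart monomials at `Gr^{3,6}` (`monoN 6 h ≤ monoN 6 t`) forces both index triples of `h` to occur
among those of `t`.
[cite: Hu2025, §3 (3.15) / §4.1 (4.7), chunks p0018 l.48–51 / p0021 l.122–132, pp. 38, 46 (unrefereed preprint arXiv:2507.21400v1 under adjudication, D-0012/D-0089 — kernel bookkeeping on OUR typed carriers of rows 101/105; nothing of the source asserted)] -/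
theorem termN_mem_of_monoN_le_six {h t : TermIdx 6} (hle : monoN 6 h ≤ monoN 6 t) :
    ((termN h).us = (termN t).us ∨ (termN h).us = (termN t).vs) ∧
    ((termN h).vs = mTri ∨ (termN h).vs = (termN t).us ∨ (termN h).vs = (termN t).vs) := by
  classical
  have hsub := Finsupp.support_mono hle
  have key : ∀ x : plVar 6, x ∈ (monoN 6 t).support → x.1 = (termN t).us ∨ x.1 = (termN t).vs := by
    intro x hx
    rw [monoN] at hx
    rcases Finset.mem_union.mp (Finsupp.support_add hx) with h1 | h1
    · exact Or.inl (eq_of_mem_support_plExp _ _ h1).symm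
    · exact Or.inr (eq_of_mem_support_plExp _ _ h1).symm
  refine ⟨key _ (hsub (us_mem_support_monoN_six h)), ?_⟩
  rcases termN_vs_six h with hm | hv
  · exact Or.inl hm
  · exact Or.inr (key _ (hsub (vs_mem_support_monoN_six h hv)))

/-- **NO DOUBLE LIFT at `Gr^{3,6}`**: for two distinct terms `t ≠ t′` of one block, the only pair of terms `h₁, h₂` of a
common block with `x̄_{h₁} ∣ x̄_{t′}` and `x̄_{h₂} ∣ x̄_t` is `(t′, t)` — the hypothesis `hNL` of `C23L47_R3_of_noDoubleLift`.
[cite: Hu2025, §3 (3.10)–(3.13) at n = 6 / §4.2.2 remark p0023 l.47–48, pp. 37, 50 (unrefereed preprint arXiv:2507.21400v1 under adjudication, D-0012/D-0089 — kernel bookkeeping on OUR typed carriers of rows 101/103/105; nothing of the source asserted)] -/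
theorem noDoubleLift_six (t t' : TermIdx 6) (htt' : relN 6 t = relN 6 t') (hne : t ≠ t') (h₁ h₂ : TermIdx 6)
    (hh : relN 6 h₁ = relN 6 h₂) (hle₁ : monoN 6 h₁ ≤ monoN 6 t') (hle₂ : monoN 6 h₂ ≤ monoN 6 t) :
    h₁ = t' ∧ h₂ = t := by
  obtain ⟨hu₁, hv₁⟩ := termN_mem_of_monoN_le_six hle₁
  obtain ⟨hu₂, hv₂⟩ := termN_mem_of_monoN_le_six hle₂
  rcases termN_lift_cases_six h₁ t' hu₁ hv₁ with rfl | ⟨hne₁, hhd₁⟩ <;>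
    rcases termN_lift_cases_six h₂ t hu₂ hv₂ with rfl | ⟨hne₂, hhd₂⟩
  · exact ⟨rfl, rfl⟩
  · exact absurd (hh.symm.trans htt'.symm) hne₂
  · exact absurd (hh.trans htt') hne₁
  · exfalso
    have h12 : h₁ = h₂ := by rw [hhd₁, hhd₂, hh]
    subst h12
    rw [hhd₁] at hu₁ hu₂
    exact head_not_double_six (relN 6 h₁) t t' htt' hne hu₂ hu₁

/-- **Hu 2025, remark after Ex. 4.14 ‹chunk 4.13› IN READING R3 — HOLDS AT THE PLATFORM `Gr^{3,6}`** (every commutative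
coefficient ring, every set `Φ` of relations in play): `C23L47_R3 (relN 6) (monoN 6) Φ`.
[cite: Hu2025, §4.2.2 remark after Ex. 4.14 ‹chunk Ex. 4.13› «a ℘-binomial does not admit any non-zero root parent», chunk p0023 l.47–48, p.50 L027; §3 (3.10)–(3.13) at n = 6 (unrefereed preprint arXiv:2507.21400v1 under adjudication, D-0012/D-0089 — kernel support on OUR typed rendering `C23L47_R3` of row 103 file d at the platform instantiation; nothing of the source asserted)] -/
theorem C23L47_R3_platform_six (k : Type) [CommRing k] (Φ : Set (RelIdx 6)) :
    C23L47_R3 (k := k) (σ := plVar 6) (relN 6) (monoN 6) Φ := by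
  classical
  exact C23L47_R3_of_noDoubleLift (k := k) (relN 6) (monoN 6) Φ
    (fun t t' htt' hne _ h₁ h₂ hh hle₁ hle₂ => noDoubleLift_six t t' htt' hne h₁ h₂ hh hle₁ hle₂)

/-- **THE THREE-READING CENSUS of «a ℘-binomial does not admit any non-zero root parent» AT `Gr^{3,6}`, `Φ = univ`, over every
nontrivial commutative coefficient ring**: reading R1 (res-type-044's parents) — refutable as typed; reading R2 (term-wise, `f̄`
unrestricted) — refutable as typed; reading R3 (term-wise, `f̄` without cancellation) — holds.
[cite: Hu2025, §4.2.2 remark after Ex. 4.14 ‹chunk Ex. 4.13›, chunk p0023 l.47–48, p.50 L027; §3 (3.10)–(3.13) at n = 6 (unrefereed preprint arXiv:2507.21400v1 under adjudication, D-0012/D-0089 — kernel facts about OUR three typed renderings `C23L47` / `C23L47_R2` / `C23L47_R3` of row 103 at the platform instantiation; nothing of the source asserted)] -/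
theorem C23L47_readings_platform_six (k : Type) [CommRing k] [Nontrivial k] :
    ¬ C23L47 (k := k) (σ := plVar 6) (relN 6) (monoN 6) Set.univ ∧
      ¬ C23L47_R2 (k := k) (σ := plVar 6) (relN 6) (monoN 6) Set.univ ∧
        C23L47_R3 (k := k) (σ := plVar 6) (relN 6) (monoN 6) Set.univ :=
  ⟨(not_C23L47_platform_six k).1, (not_C23L47_platform_six k).2, C23L47_R3_platform_six k Set.univ⟩

end Literature.AlgebraicGeometry.Hu2025.Proofs.S04ModelV

end
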